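import Mathlib

/-!
# PermTiltBlind41 — kernel of `PermTiltBlind41.md` §2–§3: the located-pencil slack of the permutahedral passenger is blind at every real diagonal tilt

val-idea-41 g3 · W6-R1 («defeat `LocatedPencilLaw`») · companion of `PermBlind41.lean` (the `U = a` case) and of
`PermTiltBlind41.md` (paper proof that `Q^Π_{4n}` is located-pencil blind ⇒ `LocatedPencilLaw` false; §2 there reduces every real
diagonal tilt to the matrix treated HERE by a layer-cake + clamp identity).

**Theorem (`permPassenger_reducedTiltBlind`).**  For every `n` there are nonnegative matrices `U` (rows = PAIRS of subsets
`(a,P)`), `V` (columns `(b,π)`), with `(n+1)³·(16n²+1)` slots, such that for all `a P b π`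
  `(1 − |a∩b|)² + |(a△P)∩(b△P)| + 4n·inv(P;π) = Σ_s U (a,P) s · V (b,π) s`,
where `inv(P;π) = #{(l∈P, l'∉P) : π l' < π l}` and `|(a△P)∩(b△P)| = Σ_l ([l∉P][l∈a][l∈b] + [l∈P][l∉a][l∉b])`
is the tilt cost of the reduced tilt `w = 𝟙_{P∖a} − 𝟙_{a∖P}` (so `𝟙_a + w = 𝟙_P`).  `P = a` is `PermBlind41.permPassenger_cliqueBlind`.

**Theorem (`permPassenger_diagTiltBlind`, §5 = K3, the finite layer cake).**  For every `n ≥ 1` there are nonnegative `U` (rows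
`(a,w) ∈ Finset (Fin n) × (Fin n → ℝ)` = clique row + ARBITRARY REAL diagonal tilt), `V` (columns `(b,π)`), with
`(n+1)³(16n²+1) + 2n + n²` slots, such that
  `(1 − |a∩b|)² + Σ_l (w_l⁺[l∉b] + w_l⁻[l∈b]) + 4n·Σ_{l,l'} (c_l − c_{l'})⁺ [π l' < π l] = Σ_s U (a,w) s · V (b,π) s`,  `c = 𝟙_a + w`,
i.e. the located-pencil (`entryTilted`, box rhs) slack of `(COR(n), Q^Π_{4n})` restricted to diagonal tilts is BLIND.  (Off-diagonal tilt
entries are entrywise atoms `W⁺(1−b_ib_m) + W⁻b_ib_m` and `λ·Def(c;π) = m(a,W) − ρ·q_π` by rearrangement — md §1, §2; with the Birkhoff EF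
of the passenger (size n²) this refutes `LocatedPencilLaw`: md §5, kernel K4–K6 pending.)

PROOF = the explicit two-case atom identity of the md (§3): blocks `(u = |P|, κ = |a∩P|; j = |b ∩ I^π_u|)`, `g̃ = κ + j − u`;
case `g̃ ≤ 0`: `(1−g̃) + m + (budget − t) + 2C(s_in,2) + 2C(s_out,2) + 2 s_out s_in + λF7 + λF8`;
case `g̃ ≥ 1`: `(g̃−1)² +` the fifteen families B0–B7 of the md.  Every factor is a product of indicators, a block constant of the
right sign, or the budget factor `λ(π l + 1 − u) − 2u − 2(g̃−1) − 2(u−κ) ≥ λ − 4n + 2`.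
Nothing here is a proof line for crux 21181 (`NNDivisionHard`); COR-VIRTUAL is untouched (the passenger is dead there by PROP D₀);
VP ≠ VNP is NOT proved.
-/

set_option linter.dupNamespace false
set_option linter.unusedVariables false
set_option linter.unusedSimpArgs false
set_option linter.unnecessarySeqFocus false
set_option maxHeartbeats 800000

namespace Summit.ValiantsHypothesis.ValiantsHypothesis.Cruxes.NNDivisionHard.PermTiltBlind41

open Finset BigOperators

noncomputable section

variable {n : ℕ}

/-! ## §0 Indicators and basic sums (verbatim from `PermBlind41.lean` §0) -/

def xa (a : Finset (Fin n)) (l : Fin n) : ℝ := if l ∈ a then 1 else 0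
def io (π : Equiv.Perm (Fin n)) (k : ℕ) (l : Fin n) : ℝ := if (π l : ℕ) < k then 1 else 0
def K (π : Equiv.Perm (Fin n)) (l l' : Fin n) : ℝ := if (π l' : ℕ) < (π l : ℕ) then 1 else 0
def invR (a : Finset (Fin n)) (π : Equiv.Perm (Fin n)) : ℝ :=
  ∑ l, ∑ l', xa a l * (1 - xa a l') * K π l l'
def inv (a : Finset (Fin n)) (π : Equiv.Perm (Fin n)) : ℕ :=
  ((univ : Finset (Fin n × Fin n)).filter
    (fun p => p.1 ∈ a ∧ p.2 ∉ a ∧ (π p.2 : ℕ) < (π p.1 : ℕ))).card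

lemma xa_nonneg (a : Finset (Fin n)) (l : Fin n) : 0 ≤ xa a l := by
  unfold xa; split_ifs <;> norm_num
lemma xa_le_one (a : Finset (Fin n)) (l : Fin n) : xa a l ≤ 1 := by
  unfold xa; split_ifs <;> norm_num
lemma xa_mul_self (a : Finset (Fin n)) (l : Fin n) : xa a l * xa a l = xa a l := by
  unfold xa; split_ifs <;> norm_num
lemma one_sub_xa_mul_self (a : Finset (Fin n)) (l : Fin n) :
    (1 - xa a l) * (1 - xa a l) = 1 - xa a l := by
  unfold xa; split_ifs <;> norm_num
lemma io_nonneg (π : Equiv.Perm (Fin n)) (k : ℕ) (l : Fin n) : 0 ≤ io π k l := by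
  unfold io; split_ifs <;> norm_num
lemma io_le_one (π : Equiv.Perm (Fin n)) (k : ℕ) (l : Fin n) : io π k l ≤ 1 := by
  unfold io; split_ifs <;> norm_num
lemma K_nonneg (π : Equiv.Perm (Fin n)) (l l' : Fin n) : 0 ≤ K π l l' := by
  unfold K; split_ifs <;> norm_num
lemma K_le_one (π : Equiv.Perm (Fin n)) (l l' : Fin n) : K π l l' ≤ 1 := by
  unfold K; split_ifs <;> norm_num

lemma sum_xa (a : Finset (Fin n)) : ∑ l, xa a l = a.card := by
  unfold xa
  rw [Finset.sum_boole]
  have : (Finset.univ.filter (fun l => l ∈ a)) = a := by ext l; simp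
  rw [this]

lemma sum_xa_mul_xa (a b : Finset (Fin n)) : ∑ l, xa a l * xa b l = ((a ∩ b).card : ℝ) := by
  have h : ∀ l, xa a l * xa b l = if l ∈ a ∩ b then (1 : ℝ) else 0 := by
    intro l
    unfold xa
    by_cases h1 : l ∈ a <;> by_cases h2 : l ∈ b <;> simp [h1, h2]
  simp_rw [h]
  rw [Finset.sum_boole]
  have h2 : (Finset.univ.filter (fun l => l ∈ a ∩ b)) = a ∩ b := by ext l; simp
  rw [h2]

lemma sum_indicator_lt (m : ℕ) (hm : m ≤ n) :
    ∑ l : Fin n, (if (l : ℕ) < m then (1 : ℝ) else 0) = m := by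
  rw [Finset.sum_boole]
  have : (Finset.univ.filter (fun l : Fin n => (l : ℕ) < m)).card = m := by
    rw [Fin.card_filter_val_lt]; omega
  rw [this]

lemma sum_io (π : Equiv.Perm (Fin n)) (k : ℕ) (hk : k ≤ n) : ∑ l, io π k l = k := by
  unfold io
  rw [Equiv.sum_comp π (fun i : Fin n => if (i : ℕ) < k then (1 : ℝ) else 0)]
  exact sum_indicator_lt k hk

lemma sum_K (π : Equiv.Perm (Fin n)) (l : Fin n) : ∑ l', K π l l' = ((π l : ℕ) : ℝ) := by
  unfold K
  rw [Equiv.sum_comp π (fun i : Fin n => if (i : ℕ) < (π l : ℕ) then (1 : ℝ) else 0)]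
  exact sum_indicator_lt (π l : ℕ) (le_of_lt (π l).isLt)

lemma K_add_K (π : Equiv.Perm (Fin n)) (l l' : Fin n) :
    K π l l' + K π l' l = if l = l' then 0 else 1 := by
  unfold K
  by_cases h : l = l'
  · subst h; simp
  · have hne : (π l : ℕ) ≠ (π l' : ℕ) := by
      intro e; apply h; exact π.injective (Fin.ext e)
    rcases lt_or_gt_of_ne hne with h1 | h1
    · have h2 : ¬ (π l' : ℕ) < (π l : ℕ) := by omega
      simp [h, h1, h2]
    · have h2 : ¬ (π l : ℕ) < (π l' : ℕ) := by omega
      simp [h, h1, h2]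

lemma io_K_io (π : Equiv.Perm (Fin n)) (k : ℕ) (l l' : Fin n) :
    io π k l * K π l l' = io π k l * (io π k l' * K π l l') := by
  unfold io K
  by_cases h1 : (π l : ℕ) < k <;> by_cases h2 : (π l' : ℕ) < (π l : ℕ) <;> simp [h1, h2]
  have h3 := lt_trans h2 h1
  simp [h3]

lemma inv_cast (a : Finset (Fin n)) (π : Equiv.Perm (Fin n)) : (inv a π : ℝ) = invR a π := by
  unfold inv invR
  rw [Finset.card_filter, Nat.cast_sum, Fintype.sum_prod_type]
  refine Finset.sum_congr rfl (fun l _ => Finset.sum_congr rfl (fun l' _ => ?_))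
  unfold xa K
  by_cases h1 : l ∈ a <;> by_cases h2 : l' ∈ a <;> by_cases h3 : (π l' : ℕ) < (π l : ℕ) <;>
    simp [h1, h2, h3]

/-! ## §1 Double-sum bookkeeping (verbatim) -/

lemma dsum_congr {F G : Fin n → Fin n → ℝ} (h : ∀ l l', F l l' = G l l') :
    ∑ l, ∑ l', F l l' = ∑ l, ∑ l', G l l' :=
  Finset.sum_congr rfl (fun l _ => Finset.sum_congr rfl (fun l' _ => h l l'))

lemma dsum_prod (f g : Fin n → ℝ) : ∑ l, ∑ l', f l * g l' = (∑ l, f l) * (∑ l', g l') := by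
  rw [Finset.sum_mul_sum]

lemma dsum_add (F G : Fin n → Fin n → ℝ) :
    ∑ l, ∑ l', (F l l' + G l l') = (∑ l, ∑ l', F l l') + ∑ l, ∑ l', G l l' := by
  simp only [Finset.sum_add_distrib]

lemma dsum_sub (F G : Fin n → Fin n → ℝ) :
    ∑ l, ∑ l', (F l l' - G l l') = (∑ l, ∑ l', F l l') - ∑ l, ∑ l', G l l' := by
  simp only [Finset.sum_sub_distrib]

lemma dsum_const_mul (c : ℝ) (F : Fin n → Fin n → ℝ) :
    ∑ l, ∑ l', c * F l l' = c * ∑ l, ∑ l', F l l' := by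
  simp only [Finset.mul_sum]

lemma dsum_delta (F : Fin n → Fin n → ℝ) :
    ∑ l, ∑ l', (if l' = l then (1 : ℝ) else 0) * F l l' = ∑ l, F l l := by
  refine Finset.sum_congr rfl (fun l _ => ?_)
  rw [Finset.sum_eq_single l]
  · simp
  · intro l' _ h; simp [h]
  · intro h; exact absurd (Finset.mem_univ l) h

/-- off-diagonal double sum of a product: `Σ_{l≠l'} f f' = (Σ f)² − Σ f` when `f² = f` pointwise. -/
lemma dsum_offdiag (f : Fin n → ℝ) (hf : ∀ l, f l * f l = f l) :
    ∑ l, ∑ l', (if l' = l then (0 : ℝ) else 1) * (f l * f l') = (∑ l, f l) * (∑ l, f l) - ∑ l, f l := by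
  have h1 : ∀ l l', (if l' = l then (0 : ℝ) else 1) * (f l * f l') =
      f l * f l' - (if l' = l then (1 : ℝ) else 0) * (f l * f l') := by
    intro l l'; split_ifs <;> ring
  rw [dsum_congr h1, dsum_sub, dsum_prod, dsum_delta]
  simp_rw [hf]

/-! ## §2 Statistics, the reduced slack, and the atom families -/

/-- `j = |I^π_u ∩ b|`. -/
def sI (π : Equiv.Perm (Fin n)) (u : ℕ) (b : Finset (Fin n)) : ℝ := ∑ l, io π u l * xa b l

lemma sI_nonneg (π : Equiv.Perm (Fin n)) (u : ℕ) (b : Finset (Fin n)) : 0 ≤ sI π u b :=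
  Finset.sum_nonneg (fun l _ => mul_nonneg (io_nonneg π u l) (xa_nonneg b l))

lemma sI_le (π : Equiv.Perm (Fin n)) (u : ℕ) (hu : u ≤ n) (b : Finset (Fin n)) : sI π u b ≤ u := by
  calc sI π u b ≤ ∑ l, io π u l := by
        refine Finset.sum_le_sum (fun l _ => ?_)
        have := mul_le_mul_of_nonneg_left (xa_le_one b l) (io_nonneg π u l)
        simpa using this
    _ = u := sum_io π u hu

/-- the tilt cost `|(a△P)∩(b△P)|` of the reduced tilt. -/
def costR (a P b : Finset (Fin n)) : ℝ :=
  ∑ l, ((1 - xa P l) * xa a l * xa b l + xa P l * (1 - xa a l) * (1 - xa b l))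

/-- **the reduced located-pencil slack** `(1−|a∩b|)² + |(a△P)∩(b△P)| + λ·inv(P;π)`. -/
def Mred (lam : ℝ) (a P b : Finset (Fin n)) (π : Equiv.Perm (Fin n)) : ℝ :=
  (1 - ∑ l, xa a l * xa b l) ^ 2 + costR a P b + lam * invR P π

/-- the joint block constant `g̃ = κ + j − u`. -/
def gt (π : Equiv.Perm (Fin n)) (b : Finset (Fin n)) (u κ : ℕ) : ℝ := (κ : ℝ) + sI π u b - u

-- scalar statistics of a row `(a,P)` against `(b, I^π_u)`
def tS (P b : Finset (Fin n)) (π : Equiv.Perm (Fin n)) (u : ℕ) : ℝ := ∑ l, xa P l * (1 - io π u l) * xa b l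
def mS (P b : Finset (Fin n)) (π : Equiv.Perm (Fin n)) (u : ℕ) : ℝ := ∑ l, (1 - xa P l) * io π u l * xa b l
def dS (P : Finset (Fin n)) (π : Equiv.Perm (Fin n)) (u : ℕ) : ℝ := ∑ l, xa P l * (1 - io π u l)
def dS' (P : Finset (Fin n)) (π : Equiv.Perm (Fin n)) (u : ℕ) : ℝ := ∑ l, (1 - xa P l) * io π u l
def eS (P : Finset (Fin n)) (π : Equiv.Perm (Fin n)) (u : ℕ) : ℝ := ∑ l, xa P l * io π u l
def zS (a P b : Finset (Fin n)) : ℝ := ∑ l, xa P l * (1 - xa a l) * (1 - xa b l)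
def bS (a P b : Finset (Fin n)) : ℝ := ∑ l, xa P l * (1 - xa a l) * xa b l
def sinS (a P b : Finset (Fin n)) : ℝ := ∑ l, xa P l * xa a l * xa b l
def soutS (a P b : Finset (Fin n)) : ℝ := ∑ l, (1 - xa P l) * xa a l * xa b l
def A6K (P : Finset (Fin n)) (π : Equiv.Perm (Fin n)) (u : ℕ) : ℝ :=
  ∑ l, xa P l * (1 - io π u l) * (((π l : ℕ) : ℝ) + 1 - u)
def F7 (P : Finset (Fin n)) (π : Equiv.Perm (Fin n)) (u : ℕ) : ℝ :=
  ∑ l, ∑ l', xa P l * xa P l' * ((1 - io π u l) * K π l' l)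
def F8 (P : Finset (Fin n)) (π : Equiv.Perm (Fin n)) (u : ℕ) : ℝ :=
  ∑ l, ∑ l', xa P l * (1 - xa P l') * (io π u l * io π u l' * K π l l')

-- row factor shapes
def rPP (a P : Finset (Fin n)) (l l' : Fin n) : ℝ := xa P l * xa P l'
def rQQ (a P : Finset (Fin n)) (l l' : Fin n) : ℝ := (1 - xa P l) * (1 - xa P l')
def rPQ (a P : Finset (Fin n)) (l l' : Fin n) : ℝ := xa P l * (1 - xa P l')
def rPZ (a P : Finset (Fin n)) (l l' : Fin n) : ℝ := xa P l * (xa P l' * (1 - xa a l'))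
def rQZ (a P : Finset (Fin n)) (l l' : Fin n) : ℝ := (1 - xa P l) * (xa P l' * (1 - xa a l'))
def rZZ (a P : Finset (Fin n)) (l l' : Fin n) : ℝ := xa P l * (1 - xa a l) * (xa P l' * (1 - xa a l'))
def rOO (a P : Finset (Fin n)) (l l' : Fin n) : ℝ := (1 - xa P l) * xa a l * ((1 - xa P l') * xa a l')
def rOI (a P : Finset (Fin n)) (l l' : Fin n) : ℝ := (1 - xa P l) * xa a l * (xa P l' * xa a l')
def rII (a P : Finset (Fin n)) (l l' : Fin n) : ℝ := xa P l * xa a l * (xa P l' * xa a l')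

section colfactors
variable (lam : ℝ) (b : Finset (Fin n)) (π : Equiv.Perm (Fin n)) (u κ : ℕ) (l l' : Fin n)
-- case B column factors (md B0–B7), with `ι = io π u`, `β = xa b`, `g̃ = gt π b u κ`
def cB0 : ℝ := (1 - io π u l) * (1 - io π u l') * xa b l * xa b l'
def cB1 : ℝ := io π u l * io π u l' * xa b l * xa b l'
def cB2 : ℝ := (1 - io π u l) * io π u l' * (2 - 2 * xa b l * xa b l')
def cB3 : ℝ := 2 * (1 - io π u l) * io π u l'
def cB4 : ℝ := (if l' = l then 1 else 0) * ((1 - io π u l) *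
    (2 * (gt π b u κ - 1) * xa b l + (lam * (((π l : ℕ) : ℝ) + 1 - u) - 2 * u - 2 * (gt π b u κ - 1) - 2 * ((u : ℝ) - κ))))
def cB5 : ℝ := (if l' = l then 1 else 0) * (io π u l * (1 - xa b l) * (2 * (gt π b u κ - 1)))
def cB6 : ℝ := (if l' = l then 1 else 0) * ((1 - xa b l) * (2 * gt π b u κ))
def cB7 : ℝ := 2 * (1 - io π u l) * xa b l * (1 - xa b l')
def cB8 : ℝ := 2 * io π u l * (1 - xa b l) * (1 - xa b l')
def cB9 : ℝ := 2 * (1 - io π u l) * xa b l'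
def cB10 : ℝ := (if l' = l then 0 else 1) * ((1 - xa b l) * (1 - xa b l'))
def cB11 : ℝ := (if l' = l then 0 else 1) * (xa b l * xa b l')
def cB12 : ℝ := 2 * xa b l * xa b l'
def cB13 : ℝ := lam * (1 - io π u l) * K π l' l
def cB14 : ℝ := lam * io π u l * io π u l' * K π l l'
-- case A column factors (md case A)
def cA0 : ℝ := (if l' = l then 1 else 0) * (io π u l * xa b l)
def cA1 : ℝ := (if l' = l then 1 else 0) * ((1 - io π u l) * (lam * (((π l : ℕ) : ℝ) + 1 - u) - xa b l))
end colfactors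

/-- row table, case B: families `(i,c) ∈ Fin 8 × Fin 2` ↦ md B-families 0..14 (+ a zero). -/
def rowB (i : Fin 8) (c : Fin 2) (a P : Finset (Fin n)) (l l' : Fin n) : ℝ :=
  ![![rPP a P l l', rQQ a P l l'], ![rPQ a P l l', rPP a P l l'], ![rPP a P l l', rQQ a P l l'],
    ![rZZ a P l l', rPZ a P l l'], ![rQZ a P l l', rPZ a P l l'], ![rZZ a P l l', rOO a P l l'],
    ![rOI a P l l', rPP a P l l'], ![rPQ a P l l', 0]] i c

def colB (i : Fin 8) (c : Fin 2) (lam : ℝ) (b : Finset (Fin n)) (π : Equiv.Perm (Fin n)) (u κ : ℕ)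
    (l l' : Fin n) : ℝ :=
  ![![cB0 b π u l l', cB1 b π u l l'], ![cB2 b π u l l', cB3 π u l l'], ![cB4 lam b π u κ l l', cB5 b π u κ l l'],
    ![cB6 b π u κ l l', cB7 b π u l l'], ![cB8 b π u l l', cB9 b π u l l'], ![cB10 b l l', cB11 b l l'],
    ![cB12 b l l', cB13 lam π u l l'], ![cB14 lam π u l l', 0]] i c

/-- row table, case A. -/
def rowA (i : Fin 8) (c : Fin 2) (a P : Finset (Fin n)) (l l' : Fin n) : ℝ :=
  ![![rQQ a P l l', rPP a P l l'], ![rII a P l l', rOO a P l l'], ![rOI a P l l', rPP a P l l'],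
    ![rPQ a P l l', 0], ![0, 0], ![0, 0], ![0, 0], ![0, 0]] i c

def colA (i : Fin 8) (c : Fin 2) (lam : ℝ) (b : Finset (Fin n)) (π : Equiv.Perm (Fin n)) (u κ : ℕ)
    (l l' : Fin n) : ℝ :=
  ![![cA0 b π u l l', cA1 lam b π u l l'], ![cB11 b l l', cB11 b l l'], ![cB12 b l l', cB13 lam π u l l'],
    ![cB14 lam π u l l', 0], ![0, 0], ![0, 0], ![0, 0], ![0, 0]] i c

/-! ### nonnegativity -/

lemma rshapes_nonneg (a P : Finset (Fin n)) (l l' : Fin n) :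
    0 ≤ rPP a P l l' ∧ 0 ≤ rQQ a P l l' ∧ 0 ≤ rPQ a P l l' ∧ 0 ≤ rPZ a P l l' ∧ 0 ≤ rQZ a P l l' ∧
    0 ≤ rZZ a P l l' ∧ 0 ≤ rOO a P l l' ∧ 0 ≤ rOI a P l l' ∧ 0 ≤ rII a P l l' := by
  have hP := xa_nonneg P l; have hP' := xa_nonneg P l'; have ha := xa_nonneg a l; have ha' := xa_nonneg a l'
  have gP : 0 ≤ 1 - xa P l := by linarith [xa_le_one P l]
  have gP' : 0 ≤ 1 - xa P l' := by linarith [xa_le_one P l']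
  have ga : 0 ≤ 1 - xa a l := by linarith [xa_le_one a l]
  have ga' : 0 ≤ 1 - xa a l' := by linarith [xa_le_one a l']
  unfold rPP rQQ rPQ rPZ rQZ rZZ rOO rOI rII
  exact ⟨mul_nonneg hP hP', mul_nonneg gP gP', mul_nonneg hP gP', mul_nonneg hP (mul_nonneg hP' ga'),
    mul_nonneg gP (mul_nonneg hP' ga'), mul_nonneg (mul_nonneg hP ga) (mul_nonneg hP' ga'),
    mul_nonneg (mul_nonneg gP ha) (mul_nonneg gP' ha'), mul_nonneg (mul_nonneg gP ha) (mul_nonneg hP' ha'),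
    mul_nonneg (mul_nonneg hP ha) (mul_nonneg hP' ha')⟩

lemma rowB_nonneg (i : Fin 8) (c : Fin 2) (a P : Finset (Fin n)) (l l' : Fin n) : 0 ≤ rowB i c a P l l' := by
  obtain ⟨h1, h2, h3, h4, h5, h6, h7, h8, h9⟩ := rshapes_nonneg a P l l'
  fin_cases i <;> fin_cases c <;> simp [rowB, h1, h2, h3, h4, h5, h6, h7, h8, h9]

lemma rowA_nonneg (i : Fin 8) (c : Fin 2) (a P : Finset (Fin n)) (l l' : Fin n) : 0 ≤ rowA i c a P l l' := by
  obtain ⟨h1, h2, h3, h4, h5, h6, h7, h8, h9⟩ := rshapes_nonneg a P l l'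
  fin_cases i <;> fin_cases c <;> simp [rowA, h1, h2, h3, h4, h5, h6, h7, h8, h9]

/-- case B column factors are nonnegative when `g̃ ≥ 1`, `λ ≥ 4n`, `u ≤ n`. -/
lemma colB_nonneg (i : Fin 8) (c : Fin 2) (lam : ℝ) (b : Finset (Fin n)) (π : Equiv.Perm (Fin n)) (u κ : ℕ)
    (hu : u ≤ n) (hlam : 4 * (n : ℝ) ≤ lam) (hg : 1 ≤ gt π b u κ) (l l' : Fin n) :
    0 ≤ colB i c lam b π u κ l l' := by
  have hl0 : 0 ≤ lam := le_trans (by positivity) hlam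
  have i0 := io_nonneg π u l; have i0' := io_nonneg π u l'
  have i1 : 0 ≤ 1 - io π u l := by linarith [io_le_one π u l]
  have i1' : 0 ≤ 1 - io π u l' := by linarith [io_le_one π u l']
  have b0 := xa_nonneg b l; have b0' := xa_nonneg b l'
  have b1 : 0 ≤ 1 - xa b l := by linarith [xa_le_one b l]
  have b1' : 0 ≤ 1 - xa b l' := by linarith [xa_le_one b l']
  have k0 := K_nonneg π l l'; have k0' := K_nonneg π l' l
  have hbb : 0 ≤ 2 - 2 * xa b l * xa b l' := by nlinarith [xa_le_one b l, xa_le_one b l']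
  have hg0 : 0 ≤ gt π b u κ := by linarith
  have hg1 : 0 ≤ gt π b u κ - 1 := by linarith
  have hsI := sI_le π u hu b
  have hun : (u : ℝ) ≤ n := by exact_mod_cast hu
  -- the budget factor
  have hbud : 0 ≤ (1 - io π u l) *
      (2 * (gt π b u κ - 1) * xa b l + (lam * (((π l : ℕ) : ℝ) + 1 - u) - 2 * u - 2 * (gt π b u κ - 1) - 2 * ((u : ℝ) - κ))) := by
    unfold io
    split_ifs with h
    · simp
    · push Not at h
      have hpos : (1 : ℝ) ≤ ((π l : ℕ) : ℝ) + 1 - u := by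
        have : (u : ℝ) ≤ ((π l : ℕ) : ℝ) := by exact_mod_cast h
        linarith
      have h2 : lam ≤ lam * (((π l : ℕ) : ℝ) + 1 - u) := by nlinarith
      have h3 : 2 * (u : ℝ) + 2 * (gt π b u κ - 1) + 2 * ((u : ℝ) - κ) ≤ 4 * n - 2 := by
        unfold gt; linarith
      have h4 : 0 ≤ 2 * (gt π b u κ - 1) * xa b l := mul_nonneg (mul_nonneg (by norm_num) hg1) b0
      rw [sub_zero, one_mul]; linarith
  have hδ : (0 : ℝ) ≤ (if l' = l then 1 else 0) := by split_ifs <;> norm_num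
  have hδ' : (0 : ℝ) ≤ (if l' = l then 0 else 1) := by split_ifs <;> norm_num
  have two0 : (0 : ℝ) ≤ 2 := by norm_num
  have c0 : 0 ≤ cB0 b π u l l' := mul_nonneg (mul_nonneg (mul_nonneg i1 i1') b0) b0'
  have c1 : 0 ≤ cB1 b π u l l' := mul_nonneg (mul_nonneg (mul_nonneg i0 i0') b0) b0'
  have c2 : 0 ≤ cB2 b π u l l' := mul_nonneg (mul_nonneg i1 i0') hbb
  have c3 : 0 ≤ cB3 π u l l' := mul_nonneg (mul_nonneg two0 i1) i0'
  have c4 : 0 ≤ cB4 lam b π u κ l l' := mul_nonneg hδ hbud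
  have c5 : 0 ≤ cB5 b π u κ l l' := mul_nonneg hδ (mul_nonneg (mul_nonneg i0 b1) (by linarith))
  have c6 : 0 ≤ cB6 b π u κ l l' := mul_nonneg hδ (mul_nonneg b1 (by linarith))
  have c7 : 0 ≤ cB7 b π u l l' := mul_nonneg (mul_nonneg (mul_nonneg two0 i1) b0) b1'
  have c8 : 0 ≤ cB8 b π u l l' := mul_nonneg (mul_nonneg (mul_nonneg two0 i0) b1) b1'
  have c9 : 0 ≤ cB9 b π u l l' := mul_nonneg (mul_nonneg two0 i1) b0'
  have c10 : 0 ≤ cB10 b l l' := mul_nonneg hδ' (mul_nonneg b1 b1')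
  have c11 : 0 ≤ cB11 b l l' := mul_nonneg hδ' (mul_nonneg b0 b0')
  have c12 : 0 ≤ cB12 b l l' := mul_nonneg (mul_nonneg two0 b0) b0'
  have c13 : 0 ≤ cB13 lam π u l l' := mul_nonneg (mul_nonneg hl0 i1) k0'
  have c14 : 0 ≤ cB14 lam π u l l' := mul_nonneg (mul_nonneg (mul_nonneg hl0 i0) i0') k0
  fin_cases i <;> fin_cases c <;>
    simp [colB, c0, c1, c2, c3, c4, c5, c6, c7, c8, c9, c10, c11, c12, c13, c14]

/-- case A column factors are nonnegative when `λ ≥ 1`. -/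
lemma colA_nonneg (i : Fin 8) (c : Fin 2) (lam : ℝ) (b : Finset (Fin n)) (π : Equiv.Perm (Fin n)) (u κ : ℕ)
    (hlam : 1 ≤ lam) (l l' : Fin n) :
    0 ≤ colA i c lam b π u κ l l' := by
  have hl0 : 0 ≤ lam := le_trans (by norm_num) hlam
  have i0 := io_nonneg π u l; have i0' := io_nonneg π u l'
  have i1 : 0 ≤ 1 - io π u l := by linarith [io_le_one π u l]
  have b0 := xa_nonneg b l; have b0' := xa_nonneg b l'
  have k0 := K_nonneg π l l'; have k0' := K_nonneg π l' l
  have hbud : 0 ≤ (1 - io π u l) * (lam * (((π l : ℕ) : ℝ) + 1 - u) - xa b l) := by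
    unfold io
    split_ifs with h
    · simp
    · push Not at h
      have hpos : (1 : ℝ) ≤ ((π l : ℕ) : ℝ) + 1 - u := by
        have : (u : ℝ) ≤ ((π l : ℕ) : ℝ) := by exact_mod_cast h
        linarith
      have h2 : lam ≤ lam * (((π l : ℕ) : ℝ) + 1 - u) := by nlinarith
      have := xa_le_one b l
      rw [sub_zero, one_mul]; linarith
  have hδ : (0 : ℝ) ≤ (if l' = l then 1 else 0) := by split_ifs <;> norm_num
  have hδ' : (0 : ℝ) ≤ (if l' = l then 0 else 1) := by split_ifs <;> norm_num
  have two0 : (0 : ℝ) ≤ 2 := by norm_num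
  have a0 : 0 ≤ cA0 b π u l l' := mul_nonneg hδ (mul_nonneg i0 b0)
  have a1 : 0 ≤ cA1 lam b π u l l' := mul_nonneg hδ hbud
  have c11 : 0 ≤ cB11 b l l' := mul_nonneg hδ' (mul_nonneg b0 b0')
  have c12 : 0 ≤ cB12 b l l' := mul_nonneg (mul_nonneg two0 b0) b0'
  have c13 : 0 ≤ cB13 lam π u l l' := mul_nonneg (mul_nonneg hl0 i1) k0'
  have c14 : 0 ≤ cB14 lam π u l l' := mul_nonneg (mul_nonneg (mul_nonneg hl0 i0) i0') k0
  fin_cases i <;> fin_cases c <;> simp [colA, a0, a1, c11, c12, c13, c14]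

/-! ## §3 The identities -/

/-- `inv(P;π) = Σ_{l∈P∖I}(π l + 1 − u) + F7 + F8` for `|P| = u` (verbatim `PermBlind41.invR_split`). -/
lemma invR_split (a : Finset (Fin n)) (π : Equiv.Perm (Fin n)) (k : ℕ) (hak : a.card = k) :
    invR a π = A6K a π k + F7 a π k + F8 a π k := by
  have hk : k ≤ n := by
    rw [← hak]; exact le_trans (Finset.card_le_univ a) (by simp)
  unfold invR A6K F7 F8
  rw [← Finset.sum_add_distrib, ← Finset.sum_add_distrib]
  refine Finset.sum_congr rfl (fun l _ => ?_)
  by_cases hl : l ∈ a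
  · have hxl : xa a l = 1 := by simp [xa, hl]
    by_cases hι : (π l : ℕ) < k
    · have hιl : io π k l = 1 := by simp [io, hι]
      simp only [hxl, hιl, sub_self, mul_zero, zero_mul, zero_add, one_mul, Finset.sum_const_zero]
      refine Finset.sum_congr rfl (fun l' _ => ?_)
      have h := io_K_io π k l l'
      rw [hιl] at h
      linear_combination (1 - xa a l') * h
    · have hιl : io π k l = 0 := by simp [io, hι]
      simp only [hxl, hιl, sub_zero, mul_one, one_mul, zero_mul, mul_zero, Finset.sum_const_zero,
        add_zero]
      have hKK : ∑ l', xa a l' * (K π l l' + K π l' l) = (k : ℝ) - 1 := by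
        have h1 : ∀ l', xa a l' * (K π l l' + K π l' l) =
            xa a l' - (if l' = l then xa a l' else 0) := by
          intro l'
          rw [K_add_K π l l']
          by_cases h : l = l'
          · subst h; simp
          · have h' : ¬ l' = l := fun e => h e.symm
            simp [h, h']
        simp_rw [h1]
        rw [Finset.sum_sub_distrib, sum_xa a, hak]
        simp [hxl]
      have hsK := sum_K π l
      have e1 : ∑ l', (1 - xa a l') * K π l l' = ∑ l', K π l l' - ∑ l', xa a l' * K π l l' := by
        rw [← Finset.sum_sub_distrib]
        refine Finset.sum_congr rfl (fun l' _ => by ring)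
      have e2 : ∑ l', xa a l' * (K π l l' + K π l' l) =
          ∑ l', xa a l' * K π l l' + ∑ l', xa a l' * K π l' l := by
        rw [← Finset.sum_add_distrib]
        refine Finset.sum_congr rfl (fun l' _ => by ring)
      rw [e1, hsK]
      rw [e2] at hKK
      linarith
  · have hxl : xa a l = 0 := by simp [xa, hl]
    simp [hxl]

section identities
variable (lam : ℝ) (a P b : Finset (Fin n)) (π : Equiv.Perm (Fin n)) (u κ : ℕ)

/-- the scalar relations among the statistics (`|P| = u`, `|a∩P| = κ`). -/
lemma stats_rel (hP : P.card = u) (hκ : (P ∩ a).card = κ) :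
    dS' P π u = dS P π u ∧ eS P π u = (u : ℝ) - dS P π u ∧
    zS a P b + bS a P b = (u : ℝ) - κ ∧
    sinS a P b = (κ : ℝ) + sI π u b - u + tS P b π u - mS P b π u + zS a P b ∧
    (∑ l, xa a l * xa b l) = sinS a P b + soutS a P b ∧
    costR a P b = soutS a P b + zS a P b := by
  have hu : u ≤ n := by rw [← hP]; exact le_trans (Finset.card_le_univ P) (by simp)
  have hxP := sum_xa P
  rw [hP] at hxP
  have hPa := sum_xa_mul_xa P a
  rw [hκ] at hPa
  have hι := sum_io π u hu
  have r1 : eS P π u + dS P π u = u := by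
    rw [← hxP, eS, dS, ← Finset.sum_add_distrib]
    exact Finset.sum_congr rfl (fun l _ => by ring)
  have r2 : dS' P π u + eS P π u = u := by
    rw [← hι, dS', eS, ← Finset.sum_add_distrib]
    exact Finset.sum_congr rfl (fun l _ => by ring)
  have r3 : zS a P b + bS a P b = (u : ℝ) - κ := by
    rw [← hxP, ← hPa, zS, bS, ← Finset.sum_add_distrib, ← Finset.sum_sub_distrib]
    exact Finset.sum_congr rfl (fun l _ => by ring)
  have r4 : sinS a P b + bS a P b = sI π u b - mS P b π u + tS P b π u := by
    rw [sinS, bS, sI, mS, tS, ← Finset.sum_add_distrib, ← Finset.sum_sub_distrib, ← Finset.sum_add_distrib]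
    exact Finset.sum_congr rfl (fun l _ => by ring)
  have r5 : (∑ l, xa a l * xa b l) = sinS a P b + soutS a P b := by
    rw [sinS, soutS, ← Finset.sum_add_distrib]
    exact Finset.sum_congr rfl (fun l _ => by ring)
  have r6 : costR a P b = soutS a P b + zS a P b := by
    rw [costR, soutS, zS, ← Finset.sum_add_distrib]
  refine ⟨by linarith, by linarith, r3, by linarith, r5, r6⟩

/-- **case B identity** (md §3, B0–B7): valid as a polynomial identity for every block. -/
theorem identityB (hP : P.card = u) (hκ : (P ∩ a).card = κ) :
    Mred lam a P b π = (gt π b u κ - 1) ^ 2 +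
      ∑ i : Fin 8, ∑ c : Fin 2, ∑ l, ∑ l', rowB i c a P l l' * colB i c lam b π u κ l l' := by
  obtain ⟨hdd, hxe, hzb, hsin, hss, hcost⟩ := stats_rel a P b π u κ hP hκ
  set s := ∑ l, xa a l * xa b l with hs_def
  set j := sI π u b with hj_def
  set g := gt π b u κ with hg_def
  set t := tS P b π u with ht_def
  set m := mS P b π u with hm_def
  set d := dS P π u with hd_def
  set d' := dS' P π u with hd'_def
  set e := eS P π u with he_def
  set z := zS a P b with hz_def
  set bb := bS a P b with hbb_def
  set si := sinS a P b with hsi_def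
  set so := soutS a P b with hso_def
  have hgj : g = (κ : ℝ) + j - u := by rw [hg_def, gt]
  -- the sixteen families
  have h00 : ∑ l, ∑ l', rowB 0 0 a P l l' * colB 0 0 lam b π u κ l l' = t * t := by
    rw [ht_def, tS, ← dsum_prod]
    exact dsum_congr (fun l l' => by simp only [rowB, colB, rPP, cB0, Matrix.cons_val_zero, Matrix.cons_val_one, Matrix.head_cons, Matrix.cons_val]; ring)
  have h01 : ∑ l, ∑ l', rowB 0 1 a P l l' * colB 0 1 lam b π u κ l l' = m * m := by
    rw [hm_def, mS, ← dsum_prod]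
    exact dsum_congr (fun l l' => by simp only [rowB, colB, rQQ, cB1, Matrix.cons_val_zero, Matrix.cons_val_one, Matrix.head_cons, Matrix.cons_val]; ring)
  have h10 : ∑ l, ∑ l', rowB 1 0 a P l l' * colB 1 0 lam b π u κ l l' = 2 * (d * d') - 2 * (t * m) := by
    rw [hd_def, hd'_def, ht_def, hm_def, dS, dS', tS, mS, ← dsum_prod, ← dsum_prod,
      ← dsum_const_mul, ← dsum_const_mul, ← dsum_sub]
    exact dsum_congr (fun l l' => by simp only [rowB, colB, rPQ, cB2, Matrix.cons_val_zero, Matrix.cons_val_one, Matrix.head_cons, Matrix.cons_val]; ring)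
  have h11 : ∑ l, ∑ l', rowB 1 1 a P l l' * colB 1 1 lam b π u κ l l' = 2 * (d * e) := by
    rw [hd_def, he_def, dS, eS, ← dsum_prod, ← dsum_const_mul]
    exact dsum_congr (fun l l' => by simp only [rowB, colB, rPP, cB3, Matrix.cons_val_zero, Matrix.cons_val_one, Matrix.head_cons, Matrix.cons_val]; ring)
  have h20 : ∑ l, ∑ l', rowB 2 0 a P l l' * colB 2 0 lam b π u κ l l' =
      2 * (g - 1) * t + (lam * A6K P π u - (2 * u + 2 * (g - 1) + 2 * ((u : ℝ) - κ)) * d) := by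
    have e1 : ∑ l, ∑ l', rowB 2 0 a P l l' * colB 2 0 lam b π u κ l l' =
        ∑ l, ∑ l', (if l' = l then (1 : ℝ) else 0) * (xa P l * xa P l' * ((1 - io π u l) *
          (2 * (g - 1) * xa b l + (lam * (((π l : ℕ) : ℝ) + 1 - u) - 2 * u - 2 * (g - 1) - 2 * ((u : ℝ) - κ))))) :=
      dsum_congr (fun l l' => by simp only [rowB, colB, rPP, cB4, Matrix.cons_val_zero, Matrix.cons_val_one, Matrix.head_cons, Matrix.cons_val, ← hg_def]; ring)
    rw [e1, dsum_delta, ht_def, hd_def, tS, dS, A6K]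
    simp only [Finset.mul_sum, ← Finset.sum_sub_distrib, ← Finset.sum_add_distrib]
    refine Finset.sum_congr rfl (fun l _ => ?_)
    have := xa_mul_self P l
    linear_combination ((1 - io π u l) * (2 * (g - 1) * xa b l +
      (lam * (((π l : ℕ) : ℝ) + 1 - u) - 2 * u - 2 * (g - 1) - 2 * ((u : ℝ) - κ)))) * this
  have h21 : ∑ l, ∑ l', rowB 2 1 a P l l' * colB 2 1 lam b π u κ l l' = 2 * (g - 1) * (d' - m) := by
    have e1 : ∑ l, ∑ l', rowB 2 1 a P l l' * colB 2 1 lam b π u κ l l' =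
        ∑ l, ∑ l', (if l' = l then (1 : ℝ) else 0) * ((1 - xa P l) * (1 - xa P l') *
          (io π u l * (1 - xa b l) * (2 * (g - 1)))) :=
      dsum_congr (fun l l' => by simp only [rowB, colB, rQQ, cB5, Matrix.cons_val_zero, Matrix.cons_val_one, Matrix.head_cons, Matrix.cons_val, ← hg_def]; ring)
    rw [e1, dsum_delta, hd'_def, hm_def, dS', mS]
    simp only [Finset.mul_sum, ← Finset.sum_sub_distrib]
    refine Finset.sum_congr rfl (fun l _ => ?_)
    have := one_sub_xa_mul_self P l
    linear_combination (io π u l * (1 - xa b l) * (2 * (g - 1))) * this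
  have h30 : ∑ l, ∑ l', rowB 3 0 a P l l' * colB 3 0 lam b π u κ l l' = 2 * g * z := by
    have e1 : ∑ l, ∑ l', rowB 3 0 a P l l' * colB 3 0 lam b π u κ l l' =
        ∑ l, ∑ l', (if l' = l then (1 : ℝ) else 0) * (xa P l * (1 - xa a l) * (xa P l' * (1 - xa a l')) *
          ((1 - xa b l) * (2 * g))) :=
      dsum_congr (fun l l' => by simp only [rowB, colB, rZZ, cB6, Matrix.cons_val_zero, Matrix.cons_val_one, Matrix.head_cons, Matrix.cons_val, ← hg_def]; ring)
    rw [e1, dsum_delta, hz_def, zS]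
    simp only [Finset.mul_sum]
    refine Finset.sum_congr rfl (fun l _ => ?_)
    have h1 := xa_mul_self P l
    have h2 := one_sub_xa_mul_self a l
    linear_combination ((1 - xa b l) * (2 * g) * ((1 - xa a l) * (1 - xa a l))) * h1 +
      ((1 - xa b l) * (2 * g) * xa P l) * h2
  have h31 : ∑ l, ∑ l', rowB 3 1 a P l l' * colB 3 1 lam b π u κ l l' = 2 * (t * z) := by
    rw [ht_def, hz_def, tS, zS, ← dsum_prod, ← dsum_const_mul]
    exact dsum_congr (fun l l' => by simp only [rowB, colB, rPZ, cB7, Matrix.cons_val_zero, Matrix.cons_val_one, Matrix.head_cons, Matrix.cons_val]; ring)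
  have h40 : ∑ l, ∑ l', rowB 4 0 a P l l' * colB 4 0 lam b π u κ l l' = 2 * ((d' - m) * z) := by
    have e0 : d' - m = ∑ l, (1 - xa P l) * io π u l * (1 - xa b l) := by
      rw [hd'_def, hm_def, dS', mS, ← Finset.sum_sub_distrib]
      exact Finset.sum_congr rfl (fun l _ => by ring)
    rw [e0, hz_def, zS, ← dsum_prod, ← dsum_const_mul]
    exact dsum_congr (fun l l' => by simp only [rowB, colB, rQZ, cB8, Matrix.cons_val_zero, Matrix.cons_val_one, Matrix.head_cons, Matrix.cons_val]; ring)
  have h41 : ∑ l, ∑ l', rowB 4 1 a P l l' * colB 4 1 lam b π u κ l l' = 2 * (d * bb) := by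
    rw [hd_def, hbb_def, dS, bS, ← dsum_prod, ← dsum_const_mul]
    exact dsum_congr (fun l l' => by simp only [rowB, colB, rPZ, cB9, Matrix.cons_val_zero, Matrix.cons_val_one, Matrix.head_cons, Matrix.cons_val]; ring)
  have h50 : ∑ l, ∑ l', rowB 5 0 a P l l' * colB 5 0 lam b π u κ l l' = z * z - z := by
    have e1 : ∑ l, ∑ l', rowB 5 0 a P l l' * colB 5 0 lam b π u κ l l' =
        ∑ l, ∑ l', (if l' = l then (0 : ℝ) else 1) * ((xa P l * (1 - xa a l) * (1 - xa b l)) *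
          (xa P l' * (1 - xa a l') * (1 - xa b l'))) :=
      dsum_congr (fun l l' => by simp only [rowB, colB, rZZ, cB10, Matrix.cons_val_zero, Matrix.cons_val_one, Matrix.head_cons, Matrix.cons_val]; ring)
    rw [e1, dsum_offdiag, hz_def, zS]
    intro l
    have h1 := xa_mul_self P l; have h2 := one_sub_xa_mul_self a l; have h3 := one_sub_xa_mul_self b l
    calc xa P l * (1 - xa a l) * (1 - xa b l) * (xa P l * (1 - xa a l) * (1 - xa b l))
        = (xa P l * xa P l) * ((1 - xa a l) * (1 - xa a l)) * ((1 - xa b l) * (1 - xa b l)) := by ring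
      _ = xa P l * (1 - xa a l) * (1 - xa b l) := by rw [h1, h2, h3]
  have h51 : ∑ l, ∑ l', rowB 5 1 a P l l' * colB 5 1 lam b π u κ l l' = so * so - so := by
    have e1 : ∑ l, ∑ l', rowB 5 1 a P l l' * colB 5 1 lam b π u κ l l' =
        ∑ l, ∑ l', (if l' = l then (0 : ℝ) else 1) * (((1 - xa P l) * xa a l * xa b l) *
          ((1 - xa P l') * xa a l' * xa b l')) :=
      dsum_congr (fun l l' => by simp only [rowB, colB, rOO, cB11, Matrix.cons_val_zero, Matrix.cons_val_one, Matrix.head_cons, Matrix.cons_val]; ring)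
    rw [e1, dsum_offdiag, hso_def, soutS]
    intro l
    have h1 := one_sub_xa_mul_self P l; have h2 := xa_mul_self a l; have h3 := xa_mul_self b l
    calc (1 - xa P l) * xa a l * xa b l * ((1 - xa P l) * xa a l * xa b l)
        = ((1 - xa P l) * (1 - xa P l)) * (xa a l * xa a l) * (xa b l * xa b l) := by ring
      _ = (1 - xa P l) * xa a l * xa b l := by rw [h1, h2, h3]
  have h60 : ∑ l, ∑ l', rowB 6 0 a P l l' * colB 6 0 lam b π u κ l l' = 2 * (so * si) := by
    rw [hso_def, hsi_def, soutS, sinS, ← dsum_prod, ← dsum_const_mul]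
    exact dsum_congr (fun l l' => by simp only [rowB, colB, rOI, cB12, Matrix.cons_val_zero, Matrix.cons_val_one, Matrix.head_cons, Matrix.cons_val]; ring)
  have h61 : ∑ l, ∑ l', rowB 6 1 a P l l' * colB 6 1 lam b π u κ l l' = lam * F7 P π u := by
    rw [F7, ← dsum_const_mul]
    exact dsum_congr (fun l l' => by simp only [rowB, colB, rPP, cB13, Matrix.cons_val_zero, Matrix.cons_val_one, Matrix.head_cons, Matrix.cons_val]; ring)
  have h70 : ∑ l, ∑ l', rowB 7 0 a P l l' * colB 7 0 lam b π u κ l l' = lam * F8 P π u := by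
    rw [F8, ← dsum_const_mul]
    exact dsum_congr (fun l l' => by simp only [rowB, colB, rPQ, cB14, Matrix.cons_val_zero, Matrix.cons_val_one, Matrix.head_cons, Matrix.cons_val]; ring)
  have h71 : ∑ l, ∑ l', rowB 7 1 a P l l' * colB 7 1 lam b π u κ l l' = 0 := by
    simp [rowB, colB]
  have hinv := invR_split P π u hP
  have hbb2 : bb = (u : ℝ) - κ - z := by linarith
  simp only [Fin.sum_univ_eight, Fin.sum_univ_two]
  rw [h00, h01, h10, h11, h20, h21, h30, h31, h40, h41, h50, h51, h60, h61, h70, h71]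
  unfold Mred
  rw [← hs_def, hcost, hinv, hss, hsin, hdd, hxe, hbb2, hgj]
  ring

/-- **case A identity** (md §3, case `g̃ ≤ 0`): valid as a polynomial identity for every block. -/
theorem identityA (hP : P.card = u) (hκ : (P ∩ a).card = κ) :
    Mred lam a P b π = (1 - gt π b u κ) +
      ∑ i : Fin 8, ∑ c : Fin 2, ∑ l, ∑ l', rowA i c a P l l' * colA i c lam b π u κ l l' := by
  obtain ⟨hdd, hxe, hzb, hsin, hss, hcost⟩ := stats_rel a P b π u κ hP hκ
  set s := ∑ l, xa a l * xa b l with hs_def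
  set j := sI π u b with hj_def
  set t := tS P b π u with ht_def
  set m := mS P b π u with hm_def
  set d := dS P π u with hd_def
  set z := zS a P b with hz_def
  set si := sinS a P b with hsi_def
  set so := soutS a P b with hso_def
  have hgj : gt π b u κ = (κ : ℝ) + j - u := by rw [gt]
  have h00 : ∑ l, ∑ l', rowA 0 0 a P l l' * colA 0 0 lam b π u κ l l' = m := by
    have e1 : ∑ l, ∑ l', rowA 0 0 a P l l' * colA 0 0 lam b π u κ l l' =
        ∑ l, ∑ l', (if l' = l then (1 : ℝ) else 0) * ((1 - xa P l) * (1 - xa P l') * (io π u l * xa b l)) :=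
      dsum_congr (fun l l' => by simp only [rowA, colA, rQQ, cA0, Matrix.cons_val_zero, Matrix.cons_val_one, Matrix.head_cons, Matrix.cons_val]; ring)
    rw [e1, dsum_delta, hm_def, mS]
    refine Finset.sum_congr rfl (fun l _ => ?_)
    have := one_sub_xa_mul_self P l
    linear_combination (io π u l * xa b l) * this
  have h01 : ∑ l, ∑ l', rowA 0 1 a P l l' * colA 0 1 lam b π u κ l l' = lam * A6K P π u - t := by
    have e1 : ∑ l, ∑ l', rowA 0 1 a P l l' * colA 0 1 lam b π u κ l l' =
        ∑ l, ∑ l', (if l' = l then (1 : ℝ) else 0) * (xa P l * xa P l' * ((1 - io π u l) *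
          (lam * (((π l : ℕ) : ℝ) + 1 - u) - xa b l))) :=
      dsum_congr (fun l l' => by simp only [rowA, colA, rPP, cA1, Matrix.cons_val_zero, Matrix.cons_val_one, Matrix.head_cons, Matrix.cons_val]; ring)
    rw [e1, dsum_delta, ht_def, tS, A6K]
    simp only [Finset.mul_sum, ← Finset.sum_sub_distrib]
    refine Finset.sum_congr rfl (fun l _ => ?_)
    have := xa_mul_self P l
    linear_combination ((1 - io π u l) * (lam * (((π l : ℕ) : ℝ) + 1 - u) - xa b l)) * this
  have h10 : ∑ l, ∑ l', rowA 1 0 a P l l' * colA 1 0 lam b π u κ l l' = si * si - si := by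
    have e1 : ∑ l, ∑ l', rowA 1 0 a P l l' * colA 1 0 lam b π u κ l l' =
        ∑ l, ∑ l', (if l' = l then (0 : ℝ) else 1) * ((xa P l * xa a l * xa b l) *
          (xa P l' * xa a l' * xa b l')) :=
      dsum_congr (fun l l' => by simp only [rowA, colA, rII, cB11, Matrix.cons_val_zero, Matrix.cons_val_one, Matrix.head_cons, Matrix.cons_val]; ring)
    rw [e1, dsum_offdiag, hsi_def, sinS]
    intro l
    have h1 := xa_mul_self P l; have h2 := xa_mul_self a l; have h3 := xa_mul_self b l
    calc xa P l * xa a l * xa b l * (xa P l * xa a l * xa b l)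
        = (xa P l * xa P l) * (xa a l * xa a l) * (xa b l * xa b l) := by ring
      _ = xa P l * xa a l * xa b l := by rw [h1, h2, h3]
  have h11 : ∑ l, ∑ l', rowA 1 1 a P l l' * colA 1 1 lam b π u κ l l' = so * so - so := by
    have e1 : ∑ l, ∑ l', rowA 1 1 a P l l' * colA 1 1 lam b π u κ l l' =
        ∑ l, ∑ l', (if l' = l then (0 : ℝ) else 1) * (((1 - xa P l) * xa a l * xa b l) *
          ((1 - xa P l') * xa a l' * xa b l')) :=
      dsum_congr (fun l l' => by simp only [rowA, colA, rOO, cB11, Matrix.cons_val_zero, Matrix.cons_val_one, Matrix.head_cons, Matrix.cons_val]; ring)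
    rw [e1, dsum_offdiag, hso_def, soutS]
    intro l
    have h1 := one_sub_xa_mul_self P l; have h2 := xa_mul_self a l; have h3 := xa_mul_self b l
    calc (1 - xa P l) * xa a l * xa b l * ((1 - xa P l) * xa a l * xa b l)
        = ((1 - xa P l) * (1 - xa P l)) * (xa a l * xa a l) * (xa b l * xa b l) := by ring
      _ = (1 - xa P l) * xa a l * xa b l := by rw [h1, h2, h3]
  have h20 : ∑ l, ∑ l', rowA 2 0 a P l l' * colA 2 0 lam b π u κ l l' = 2 * (so * si) := by
    rw [hso_def, hsi_def, soutS, sinS, ← dsum_prod, ← dsum_const_mul]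
    exact dsum_congr (fun l l' => by simp only [rowA, colA, rOI, cB12, Matrix.cons_val_zero, Matrix.cons_val_one, Matrix.head_cons, Matrix.cons_val]; ring)
  have h21 : ∑ l, ∑ l', rowA 2 1 a P l l' * colA 2 1 lam b π u κ l l' = lam * F7 P π u := by
    rw [F7, ← dsum_const_mul]
    exact dsum_congr (fun l l' => by simp only [rowA, colA, rPP, cB13, Matrix.cons_val_zero, Matrix.cons_val_one, Matrix.head_cons, Matrix.cons_val]; ring)
  have h30 : ∑ l, ∑ l', rowA 3 0 a P l l' * colA 3 0 lam b π u κ l l' = lam * F8 P π u := by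
    rw [F8, ← dsum_const_mul]
    exact dsum_congr (fun l l' => by simp only [rowA, colA, rPQ, cB14, Matrix.cons_val_zero, Matrix.cons_val_one, Matrix.head_cons, Matrix.cons_val]; ring)
  have hz : ∀ i : Fin 8, ∀ c : Fin 2, rowA i c a P = (fun _ _ => 0) ∨ colA i c lam b π u κ = (fun _ _ => 0) →
      ∑ l, ∑ l', rowA i c a P l l' * colA i c lam b π u κ l l' = 0 := by
    intro i c h
    rcases h with h | h <;> simp [h]
  have z31 := hz 3 1 (Or.inl (by funext l l'; simp [rowA]))
  have z40 := hz 4 0 (Or.inl (by funext l l'; simp [rowA]))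
  have z41 := hz 4 1 (Or.inl (by funext l l'; simp [rowA]))
  have z50 := hz 5 0 (Or.inl (by funext l l'; simp [rowA]))
  have z51 := hz 5 1 (Or.inl (by funext l l'; simp [rowA]))
  have z60 := hz 6 0 (Or.inl (by funext l l'; simp [rowA]))
  have z61 := hz 6 1 (Or.inl (by funext l l'; simp [rowA]))
  have z70 := hz 7 0 (Or.inl (by funext l l'; simp [rowA]))
  have z71 := hz 7 1 (Or.inl (by funext l l'; simp [rowA]))
  have hinv := invR_split P π u hP
  simp only [Fin.sum_univ_eight, Fin.sum_univ_two]
  rw [h00, h01, h10, h11, h20, h21, h30]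
  rw [z31, z40, z41, z50, z51, z60, z61, z70, z71]
  unfold Mred
  rw [← hs_def, hcost, hinv, hss, hsin, hgj]
  ring

end identities

/-! ## §4 Packaging: a nonnegative factorization with `(n+1)³(16n²+1)` slots -/

/-- block index `(u, κ, j)` and either the constant atom or a family/pair atom. -/
abbrev Slot (n : ℕ) := (Fin (n + 1) × Fin (n + 1) × Fin (n + 1)) × Option (Fin 8 × Fin 2 × Fin n × Fin n)

lemma card_Slot (n : ℕ) : Fintype.card (Slot n) = (n + 1) ^ 3 * (16 * n ^ 2 + 1) := by
  simp [Slot, Fintype.card_prod, Fintype.card_option, Fintype.card_fin]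
  ring

/-- the case selector: case B iff `u + 1 ≤ κ + j` (i.e. `g̃ ≥ 1`). -/
def caseB (u κ j : ℕ) : Bool := decide (u + 1 ≤ κ + j)

/-- `|I^π_u ∩ b|` as a natural number. -/
def jN (π : Equiv.Perm (Fin n)) (u : ℕ) (b : Finset (Fin n)) : ℕ :=
  (b.filter (fun l => (π l : ℕ) < u)).card

lemma sI_eq_jN (π : Equiv.Perm (Fin n)) (u : ℕ) (b : Finset (Fin n)) : sI π u b = jN π u b := by
  unfold sI jN
  have hset : b.filter (fun l => (π l : ℕ) < u) = (univ : Finset (Fin n)).filter (fun l => (π l : ℕ) < u ∧ l ∈ b) := by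
    ext l; simp [and_comm]
  rw [hset, Finset.card_filter, Nat.cast_sum]
  refine Finset.sum_congr rfl (fun l _ => ?_)
  unfold io xa
  by_cases h1 : (π l : ℕ) < u <;> by_cases h2 : l ∈ b <;> simp [h1, h2]

lemma jN_le (π : Equiv.Perm (Fin n)) (u : ℕ) (b : Finset (Fin n)) : jN π u b ≤ n := by
  unfold jN
  exact le_trans (Finset.card_le_card (Finset.filter_subset _ b)) (le_trans (Finset.card_le_univ b) (by simp))

/-- the row matrix. -/
def Urow (r : Finset (Fin n) × Finset (Fin n)) : Slot n → ℝ
  | ((u, κ, j), none) => if r.2.card = (u : ℕ) ∧ (r.2 ∩ r.1).card = (κ : ℕ) then 1 else 0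
  | ((u, κ, j), some (i, c, l, l')) =>
      (if r.2.card = (u : ℕ) ∧ (r.2 ∩ r.1).card = (κ : ℕ) then 1 else 0) *
        (if caseB u κ j then rowB i c r.1 r.2 l l' else rowA i c r.1 r.2 l l')

/-- the column matrix. -/
def Vcol (lam : ℝ) (q : Finset (Fin n) × Equiv.Perm (Fin n)) : Slot n → ℝ
  | ((u, κ, j), none) => (if jN q.2 u q.1 = (j : ℕ) then 1 else 0) *
      (if caseB u κ j then (gt q.2 q.1 u κ - 1) ^ 2 else (1 - gt q.2 q.1 u κ))
  | ((u, κ, j), some (i, c, l, l')) => (if jN q.2 u q.1 = (j : ℕ) then 1 else 0) *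
      (if caseB u κ j then colB i c lam q.1 q.2 u κ l l' else colA i c lam q.1 q.2 u κ l l')

lemma Urow_nonneg (r : Finset (Fin n) × Finset (Fin n)) (s : Slot n) : 0 ≤ Urow r s := by
  rcases s with ⟨⟨u, κ, j⟩, _ | ⟨i, c, l, l'⟩⟩
  · simp only [Urow]; split_ifs <;> norm_num
  · simp only [Urow]
    refine mul_nonneg (by split_ifs <;> norm_num) ?_
    split_ifs
    · exact rowB_nonneg i c r.1 r.2 l l'
    · exact rowA_nonneg i c r.1 r.2 l l'

lemma Vcol_nonneg (lam : ℝ) (hlam : 4 * (n : ℝ) ≤ lam) (hlam1 : 1 ≤ lam)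
    (q : Finset (Fin n) × Equiv.Perm (Fin n)) (s : Slot n) : 0 ≤ Vcol lam q s := by
  rcases s with ⟨⟨u, κ, j⟩, o⟩
  have hu : (u : ℕ) ≤ n := Nat.lt_succ_iff.mp u.isLt
  by_cases hj : jN q.2 u q.1 = (j : ℕ)
  · have hgt : gt q.2 q.1 u κ = (κ : ℝ) + (j : ℕ) - (u : ℕ) := by
      rw [gt, sI_eq_jN, hj]
    rcases o with _ | ⟨i, c, l, l'⟩
    · have e : Vcol lam q ((u, κ, j), none) =
          (if caseB u κ j then (gt q.2 q.1 u κ - 1) ^ 2 else (1 - gt q.2 q.1 u κ)) := by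
        simp [Vcol, hj]
      rw [e]
      split_ifs with hc
      · positivity
      · have : (κ : ℝ) + (j : ℕ) - (u : ℕ) ≤ 0 := by
          have hc2 : ¬ ((u : ℕ) + 1 ≤ (κ : ℕ) + (j : ℕ)) := by simpa [caseB] using hc
          have h2 : ((κ : ℕ) : ℝ) + ((j : ℕ) : ℝ) ≤ ((u : ℕ) : ℝ) := by
            have : (κ : ℕ) + (j : ℕ) ≤ (u : ℕ) := by omega
            exact_mod_cast this
          linarith
        rw [hgt]; linarith
    · have e : Vcol lam q ((u, κ, j), some (i, c, l, l')) =
          (if caseB u κ j then colB i c lam q.1 q.2 u κ l l' else colA i c lam q.1 q.2 u κ l l') := by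
        simp [Vcol, hj]
      rw [e]
      split_ifs with hc
      · have hg : 1 ≤ gt q.2 q.1 u κ := by
          rw [hgt]
          have hc2 : (u : ℕ) + 1 ≤ (κ : ℕ) + (j : ℕ) := by simpa [caseB] using hc
          have : ((u : ℕ) : ℝ) + 1 ≤ ((κ : ℕ) : ℝ) + ((j : ℕ) : ℝ) := by exact_mod_cast hc2
          linarith
        exact colB_nonneg i c lam q.1 q.2 u κ hu hlam hg l l'
      · exact colA_nonneg i c lam q.1 q.2 u κ hlam1 l l'
  · rcases o with _ | ⟨i, c, l, l'⟩ <;> simp [Vcol, hj]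

/-- the factorization `Mred = Urow · Vcolᵀ`. -/
theorem factorization (lam : ℝ) (a P b : Finset (Fin n)) (π : Equiv.Perm (Fin n)) :
    ∑ s : Slot n, Urow (a, P) s * Vcol lam (b, π) s = Mred lam a P b π := by
  have hu : P.card < n + 1 := Nat.lt_succ_of_le (le_trans (Finset.card_le_univ P) (by simp))
  have hκ : (P ∩ a).card < n + 1 :=
    Nat.lt_succ_of_le (le_trans (Finset.card_le_card Finset.inter_subset_left) (le_trans (Finset.card_le_univ P) (by simp)))
  have hj : jN π P.card b < n + 1 := Nat.lt_succ_of_le (jN_le π _ b)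
  set u₀ : Fin (n + 1) := ⟨P.card, hu⟩ with hu₀
  set κ₀ : Fin (n + 1) := ⟨(P ∩ a).card, hκ⟩ with hκ₀
  set j₀ : Fin (n + 1) := ⟨jN π P.card b, hj⟩ with hj₀
  rw [Fintype.sum_prod_type]
  rw [Finset.sum_eq_single (u₀, κ₀, j₀)]
  · rw [Fintype.sum_option]
    have hU0 : Urow (a, P) ((u₀, κ₀, j₀), none) = 1 := by simp [Urow, hu₀, hκ₀]
    have hjm : jN π (u₀ : ℕ) b = (j₀ : ℕ) := by simp [hu₀, hj₀]
    rw [hU0, one_mul]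
    have hsome : ∀ (RC : Fin 8 → Fin 2 → Fin n → Fin n → ℝ),
        (∀ i c l l', Urow (a, P) ((u₀, κ₀, j₀), some (i, c, l, l')) * Vcol lam (b, π) ((u₀, κ₀, j₀), some (i, c, l, l'))
          = RC i c l l') →
        ∑ x : Fin 8 × Fin 2 × Fin n × Fin n,
            Urow (a, P) ((u₀, κ₀, j₀), some x) * Vcol lam (b, π) ((u₀, κ₀, j₀), some x)
          = ∑ i, ∑ c, ∑ l, ∑ l', RC i c l l' := by
      intro RC hRC
      rw [Fintype.sum_prod_type]
      refine Finset.sum_congr rfl (fun i _ => ?_)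
      rw [Fintype.sum_prod_type]
      refine Finset.sum_congr rfl (fun c _ => ?_)
      rw [Fintype.sum_prod_type]
      exact Finset.sum_congr rfl (fun l _ => Finset.sum_congr rfl (fun l' _ => hRC i c l l'))
    have hjm' : jN π P.card b = (j₀ : ℕ) := hjm
    by_cases hc : caseB u₀ κ₀ j₀ = true
    · have hc' : caseB P.card (P ∩ a).card (j₀ : ℕ) = true := hc
      have hmain := identityB lam a P b π (u₀ : ℕ) (κ₀ : ℕ) (by simp [hu₀]) (by simp [hκ₀])
      have hV0 : Vcol lam (b, π) ((u₀, κ₀, j₀), none) = (gt π b u₀ κ₀ - 1) ^ 2 := by simp [Vcol, hjm, hc]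
      rw [hmain, hV0, hsome (fun i c l l' => rowB i c a P l l' * colB i c lam b π u₀ κ₀ l l')
        (fun i c l l' => by simp [Urow, Vcol, hu₀, hκ₀, hjm', hc'])]
    · have hc' : ¬ caseB P.card (P ∩ a).card (j₀ : ℕ) = true := hc
      have hmain := identityA lam a P b π (u₀ : ℕ) (κ₀ : ℕ) (by simp [hu₀]) (by simp [hκ₀])
      have hV0 : Vcol lam (b, π) ((u₀, κ₀, j₀), none) = 1 - gt π b u₀ κ₀ := by simp [Vcol, hjm, hc]
      rw [hmain, hV0, hsome (fun i c l l' => rowA i c a P l l' * colA i c lam b π u₀ κ₀ l l')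
        (fun i c l l' => by simp [Urow, Vcol, hu₀, hκ₀, hjm', hc'])]
  · rintro ⟨u, κ, j⟩ _ hne
    apply Finset.sum_eq_zero
    intro o _
    by_cases hb : P.card = (u : ℕ) ∧ (P ∩ a).card = (κ : ℕ)
    · -- then the column index `j` must be wrong
      have hjne : ¬ jN π u b = (j : ℕ) := by
        intro hjj
        apply hne
        obtain ⟨h1, h2⟩ := hb
        have e1 : u = u₀ := Fin.ext (by simp [hu₀, h1])
        have e2 : κ = κ₀ := Fin.ext (by simp [hκ₀, h2])
        have e3 : j = j₀ := Fin.ext (by simp [hj₀, ← hjj, ← h1])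
        rw [e1, e2, e3]
      rcases o with _ | ⟨i, c, l, l'⟩ <;> simp [Vcol, hjne]
    · rcases o with _ | ⟨i, c, l, l'⟩ <;> simp [Urow, hb]
  · intro h; exact absurd (Finset.mem_univ _) h

/-- **Main theorem.**  The REDUCED located-pencil slack of the permutahedral passenger `Q^Π_{4n}` is blind:
`(1 − |a∩b|)² + |(a△P)∩(b△P)| + 4n·inv(P;π)` has a nonnegative factorization with `(n+1)³(16n²+1)` slots
(for `n ≥ 1`; rows are pairs `(a,P)`, columns `(b,π)`). -/
theorem permPassenger_reducedTiltBlind (n : ℕ) (hn : 1 ≤ n) :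
    ∃ (U : Finset (Fin n) × Finset (Fin n) → Slot n → ℝ) (V : Finset (Fin n) × Equiv.Perm (Fin n) → Slot n → ℝ),
      Fintype.card (Slot n) = (n + 1) ^ 3 * (16 * n ^ 2 + 1) ∧
      (∀ r s, 0 ≤ U r s) ∧ (∀ q s, 0 ≤ V q s) ∧
      ∀ (a P b : Finset (Fin n)) (π : Equiv.Perm (Fin n)),
        (1 - ((a ∩ b).card : ℝ)) ^ 2
          + (∑ l : Fin n, ((if l ∉ P ∧ l ∈ a ∧ l ∈ b then (1 : ℝ) else 0) + (if l ∈ P ∧ l ∉ a ∧ l ∉ b then (1 : ℝ) else 0)))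
          + (4 * n) * (inv P π : ℝ) = ∑ s, U (a, P) s * V (b, π) s := by
  have hlam : 4 * (n : ℝ) ≤ 4 * n := le_rfl
  have hlam1 : (1 : ℝ) ≤ 4 * n := by
    have : (1 : ℝ) ≤ n := by exact_mod_cast hn
    linarith
  refine ⟨Urow, Vcol (4 * n), card_Slot n, Urow_nonneg, Vcol_nonneg _ hlam hlam1, ?_⟩
  intro a P b π
  rw [factorization, Mred, sum_xa_mul_xa, inv_cast, costR]
  congr 2
  refine Finset.sum_congr rfl (fun l _ => ?_)
  unfold xa
  by_cases h1 : l ∈ P <;> by_cases h2 : l ∈ a <;> by_cases h3 : l ∈ b <;> simp [h1, h2, h3]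


/-! ## §5 Real diagonal tilts: the finite layer cake (K3 of `PermTiltBlind41.md` §2)

For a real diagonal tilt `w` put `c = 𝟙_a + w`, `ĉ = clamp(c,0,1)`, sort `ĉ` ascending (`Tuple.sort`), and let
`T_r = {l : r ≤ rank l}` (`r = 0..n`) be the chain of upper sets with weights `wt_r = ĉ_(r) − ĉ_(r−1)` (`ĉ_(−1) := 0`,
`ĉ_(n) := 1`).  Then `Σ_r wt_r [l ∈ T_r] = ĉ_l`, `Σ_r wt_r [l ∈ T_r][l' ∉ T_r] = (ĉ_l − ĉ_l')⁺`, `Σ_r wt_r = 1`, and the located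
pencil slack of the diagonal tilt is `Σ_r wt_r · S_red(a,T_r) + atoms` — so the reduced factorization of §4 integrates to a
factorization for ALL real diagonal tilts (`permPassenger_diagTiltBlind`). -/

section cake

def clamp01 (x : ℝ) : ℝ := max 0 (min 1 x)
def posPart' (x : ℝ) : ℝ := max x 0

lemma clamp01_nonneg (x : ℝ) : 0 ≤ clamp01 x := le_max_left _ _
lemma clamp01_le_one (x : ℝ) : clamp01 x ≤ 1 := max_le (by norm_num) (min_le_left _ _)
lemma clamp01_mono {x y : ℝ} (h : x ≤ y) : clamp01 x ≤ clamp01 y := by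
  simp only [clamp01, max_def, min_def]; split_ifs <;> linarith
lemma clamp01_lip {x y : ℝ} (h : y ≤ x) : clamp01 x - clamp01 y ≤ x - y := by
  simp only [clamp01, max_def, min_def]; split_ifs <;> linarith
lemma posPart'_nonneg (x : ℝ) : 0 ≤ posPart' x := le_max_right _ _
lemma posPart'_mono {x y : ℝ} (h : x ≤ y) : posPart' x ≤ posPart' y := max_le_max h le_rfl

/-- `(c_l − c_l')⁺ − (ĉ_l − ĉ_l')⁺ ≥ 0` (clamping is monotone and 1-Lipschitz). -/
lemma tiltPair_nonneg (x y : ℝ) : 0 ≤ posPart' (x - y) - posPart' (clamp01 x - clamp01 y) := by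
  rcases le_total x y with h | h
  · have h1 : clamp01 x - clamp01 y ≤ 0 := by linarith [clamp01_mono h]
    have h2 : posPart' (clamp01 x - clamp01 y) = 0 := by
      unfold posPart'; exact max_eq_right h1
    rw [h2]; linarith [posPart'_nonneg (x - y)]
  · linarith [posPart'_mono (clamp01_lip h)]

/-- the per-coordinate cost identity behind the layer cake (`α = [l∈a]`, `β = [l∈b]`). -/
lemma cost_atom (w α β : ℝ) (hα : α = 0 ∨ α = 1) (hβ : β = 0 ∨ β = 1) :
    posPart' w * (1 - β) + posPart' (-w) * β =
      (1 - clamp01 (α + w)) * α * β + clamp01 (α + w) * (1 - α) * (1 - β)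
        + posPart' (α + w - 1) * (1 - β) + posPart' (-(α + w)) * β := by
  rcases hα with hα | hα <;> rcases hβ with hβ | hβ <;> subst hα <;> subst hβ <;>
    simp only [posPart', clamp01, max_def, min_def] <;> split_ifs <;> linarith

variable (c : Fin n → ℝ)

def chat : Fin n → ℝ := fun l => clamp01 (c l)
def srt : Equiv.Perm (Fin n) := Tuple.sort (chat c)
def rk (l : Fin n) : ℕ := (((srt c).symm l : Fin n) : ℕ)
def Ech (r : ℕ) : ℝ := if h : r < n then chat c (srt c ⟨r, h⟩) else 1
def wt (r : Fin (n + 1)) : ℝ := Ech c r - (if (r : ℕ) = 0 then 0 else Ech c ((r : ℕ) - 1))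
def Tset (r : ℕ) : Finset (Fin n) := univ.filter (fun l => r ≤ rk c l)

lemma rk_lt (l : Fin n) : rk c l < n := ((srt c).symm l).isLt

lemma Ech_rk (l : Fin n) : Ech c (rk c l) = chat c l := by
  unfold Ech
  rw [dif_pos (rk_lt c l)]
  have : (⟨rk c l, rk_lt c l⟩ : Fin n) = (srt c).symm l := Fin.ext rfl
  rw [this, Equiv.apply_symm_apply]

lemma Ech_mono {r r' : ℕ} (h : r ≤ r') (hr' : r' < n) : Ech c r ≤ Ech c r' := by
  unfold Ech
  rw [dif_pos (lt_of_le_of_lt h hr'), dif_pos hr']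
  exact Tuple.monotone_sort (chat c) (Fin.mk_le_mk.mpr h)

lemma Ech_le_one (r : ℕ) : Ech c r ≤ 1 := by
  unfold Ech; split_ifs
  · exact clamp01_le_one _
  · exact le_rfl

lemma Ech_nonneg (r : ℕ) : 0 ≤ Ech c r := by
  unfold Ech; split_ifs
  · exact clamp01_nonneg _
  · norm_num

lemma Ech_step (r : ℕ) (hrn : r ≤ n) : Ech c (r - 1) ≤ Ech c r := by
  by_cases h : r < n
  · exact Ech_mono c (Nat.sub_le r 1) h
  · have hr : r = n := le_antisymm hrn (not_lt.mp h)
    have : Ech c r = 1 := by unfold Ech; rw [dif_neg h]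
    rw [this]; exact Ech_le_one c _

lemma wt_nonneg (r : Fin (n + 1)) : 0 ≤ wt c r := by
  unfold wt
  split_ifs with h
  · linarith [Ech_nonneg c r]
  · linarith [Ech_step c r (Nat.lt_succ_iff.mp r.isLt)]

/-- telescoping over `range`. -/
lemma tel_range (E : ℕ → ℝ) (ρ : ℕ) :
    ∑ r ∈ Finset.range (ρ + 1), (E r - (if r = 0 then 0 else E (r - 1))) = E ρ := by
  induction ρ with
  | zero => simp
  | succ k ih =>
    rw [Finset.sum_range_succ, ih]
    simp

/-- `Σ_r wt_r [r ≤ ρ] = ĉ_(ρ)`. -/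
lemma sum_wt_le (ρ : ℕ) (hρ : ρ ≤ n) :
    ∑ r : Fin (n + 1), wt c r * (if (r : ℕ) ≤ ρ then 1 else 0) = Ech c ρ := by
  have h1 : ∑ r : Fin (n + 1), wt c r * (if (r : ℕ) ≤ ρ then 1 else 0) =
      ∑ r ∈ Finset.range (n + 1),
        (Ech c r - (if r = 0 then 0 else Ech c (r - 1))) * (if r ≤ ρ then 1 else 0) := by
    rw [← Fin.sum_univ_eq_sum_range
      (fun r => (Ech c r - (if r = 0 then 0 else Ech c (r - 1))) * (if r ≤ ρ then 1 else 0)) (n + 1)]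
    rfl
  rw [h1]
  have h2 : ∑ r ∈ Finset.range (n + 1),
        (Ech c r - (if r = 0 then 0 else Ech c (r - 1))) * (if r ≤ ρ then 1 else 0) =
      ∑ r ∈ Finset.range (n + 1),
        (if r ≤ ρ then (Ech c r - (if r = 0 then 0 else Ech c (r - 1))) else 0) := by
    refine Finset.sum_congr rfl (fun r _ => ?_)
    split_ifs <;> simp
  rw [h2, ← Finset.sum_filter]
  have h3 : (Finset.range (n + 1)).filter (fun r => r ≤ ρ) = Finset.range (ρ + 1) := by
    ext r; simp; omega
  rw [h3, tel_range]

lemma sum_wt : ∑ r : Fin (n + 1), wt c r = 1 := by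
  have h := sum_wt_le c n le_rfl
  have h2 : ∀ r : Fin (n + 1), wt c r * (if (r : ℕ) ≤ n then (1 : ℝ) else 0) = wt c r := by
    intro r; rw [if_pos (Nat.lt_succ_iff.mp r.isLt), mul_one]
  simp_rw [h2] at h
  rw [h]; unfold Ech; rw [dif_neg (lt_irrefl n)]

lemma xa_Tset (r : ℕ) (l : Fin n) : xa (Tset c r) l = if r ≤ rk c l then 1 else 0 := by
  simp [xa, Tset]

/-- **per-coordinate layer cake** `Σ_r wt_r [l ∈ T_r] = ĉ_l`. -/
lemma cake_coord (l : Fin n) : ∑ r : Fin (n + 1), wt c r * xa (Tset c r) l = chat c l := by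
  simp_rw [xa_Tset]
  rw [sum_wt_le c (rk c l) (le_of_lt (rk_lt c l)), Ech_rk]

/-- **pair layer cake** `Σ_r wt_r [l ∈ T_r][l' ∉ T_r] = (ĉ_l − ĉ_l')⁺`. -/
lemma cake_pair (l l' : Fin n) :
    ∑ r : Fin (n + 1), wt c r * (xa (Tset c r) l * (1 - xa (Tset c r) l')) =
      posPart' (chat c l - chat c l') := by
  simp_rw [xa_Tset]
  by_cases h : rk c l' < rk c l
  · have e : ∀ r : Fin (n + 1), wt c r * ((if (r : ℕ) ≤ rk c l then (1 : ℝ) else 0) *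
        (1 - if (r : ℕ) ≤ rk c l' then (1 : ℝ) else 0)) =
        wt c r * (if (r : ℕ) ≤ rk c l then 1 else 0) - wt c r * (if (r : ℕ) ≤ rk c l' then 1 else 0) := by
      intro r
      by_cases h1 : (r : ℕ) ≤ rk c l <;> by_cases h2 : (r : ℕ) ≤ rk c l' <;> simp [h1, h2] <;> omega
    simp_rw [e]
    rw [Finset.sum_sub_distrib, sum_wt_le c _ (le_of_lt (rk_lt c l)), sum_wt_le c _ (le_of_lt (rk_lt c l')),
      Ech_rk, Ech_rk]
    have hle : chat c l' ≤ chat c l := by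
      rw [← Ech_rk c l, ← Ech_rk c l']
      exact Ech_mono c (le_of_lt h) (rk_lt c l)
    unfold posPart'; rw [max_eq_left (by linarith)]
  · have e : ∀ r : Fin (n + 1), wt c r * ((if (r : ℕ) ≤ rk c l then (1 : ℝ) else 0) *
        (1 - if (r : ℕ) ≤ rk c l' then (1 : ℝ) else 0)) = 0 := by
      intro r
      by_cases h1 : (r : ℕ) ≤ rk c l <;> by_cases h2 : (r : ℕ) ≤ rk c l' <;> simp [h1, h2] <;> omega
    simp_rw [e]
    rw [Finset.sum_const_zero]
    have hle : chat c l ≤ chat c l' := by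
      rw [← Ech_rk c l, ← Ech_rk c l']
      exact Ech_mono c (not_lt.mp h) (rk_lt c l')
    unfold posPart'; rw [max_eq_right (by linarith)]

end cake

/-! ### the diagonal located-pencil slack and its factorization -/

section diag

/-- `Def(c;π) = Σ_{l,l'} (c_l − c_l')⁺ [π l' < π l]` — the passenger part `(m(a,w) − ρ·q_π)/λ` of the located slack. -/
def Def (c : Fin n → ℝ) (π : Equiv.Perm (Fin n)) : ℝ := ∑ l, ∑ l', posPart' (c l - c l') * K π l l'

/-- **the located-pencil slack of `Q^Π_λ` at a real DIAGONAL tilt `w` of the clique row `a`** (md §2):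
`(1 − |a∩b|)² + Σ_l (w_l⁺(1−b_l) + w_l⁻ b_l) + λ·Def(𝟙_a + w; π)`. -/
def Sdiag (lam : ℝ) (a : Finset (Fin n)) (w : Fin n → ℝ) (b : Finset (Fin n)) (π : Equiv.Perm (Fin n)) : ℝ :=
  (1 - ∑ l, xa a l * xa b l) ^ 2 + ∑ l, (posPart' (w l) * (1 - xa b l) + posPart' (-(w l)) * xa b l)
    + lam * Def (fun l => xa a l + w l) π

/-- slots: the reduced slots, plus `2n` clamp atoms and `n²` Def atoms. -/
abbrev SlotD (n : ℕ) := Slot n ⊕ ((Fin n ⊕ Fin n) ⊕ (Fin n × Fin n))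

lemma card_SlotD (n : ℕ) : Fintype.card (SlotD n) = (n + 1) ^ 3 * (16 * n ^ 2 + 1) + (2 * n + n ^ 2) := by
  simp [SlotD, Fintype.card_sum, Fintype.card_prod, Fintype.card_fin, card_Slot]
  ring

/-- the tilt vector `c = 𝟙_a + w`. -/
def cvec (a : Finset (Fin n)) (w : Fin n → ℝ) : Fin n → ℝ := fun l => xa a l + w l

def UD (lam : ℝ) (r : Finset (Fin n) × (Fin n → ℝ)) : SlotD n → ℝ
  | Sum.inl s => ∑ k : Fin (n + 1), wt (cvec r.1 r.2) k * Urow (r.1, Tset (cvec r.1 r.2) k) s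
  | Sum.inr (Sum.inl (Sum.inl l)) => posPart' (cvec r.1 r.2 l - 1)
  | Sum.inr (Sum.inl (Sum.inr l)) => posPart' (-(cvec r.1 r.2 l))
  | Sum.inr (Sum.inr (l, l')) => lam * (posPart' (cvec r.1 r.2 l - cvec r.1 r.2 l')
      - posPart' (chat (cvec r.1 r.2) l - chat (cvec r.1 r.2) l'))

def VD (lam : ℝ) (q : Finset (Fin n) × Equiv.Perm (Fin n)) : SlotD n → ℝ
  | Sum.inl s => Vcol lam q s
  | Sum.inr (Sum.inl (Sum.inl l)) => 1 - xa q.1 l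
  | Sum.inr (Sum.inl (Sum.inr l)) => xa q.1 l
  | Sum.inr (Sum.inr (l, l')) => K q.2 l l'

lemma UD_nonneg (lam : ℝ) (hl : 0 ≤ lam) (r : Finset (Fin n) × (Fin n → ℝ)) (s : SlotD n) : 0 ≤ UD lam r s := by
  rcases s with s | ((l | l) | ⟨l, l'⟩)
  · exact Finset.sum_nonneg (fun k _ => mul_nonneg (wt_nonneg _ k) (Urow_nonneg _ s))
  · exact posPart'_nonneg _
  · exact posPart'_nonneg _
  · simp only [UD]
    exact mul_nonneg hl (by
      have := tiltPair_nonneg (cvec r.1 r.2 l) (cvec r.1 r.2 l')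
      simpa [chat] using this)

lemma VD_nonneg (lam : ℝ) (hlam : 4 * (n : ℝ) ≤ lam) (hlam1 : 1 ≤ lam)
    (q : Finset (Fin n) × Equiv.Perm (Fin n)) (s : SlotD n) : 0 ≤ VD lam q s := by
  rcases s with s | ((l | l) | ⟨l, l'⟩)
  · exact Vcol_nonneg lam hlam hlam1 q s
  · simp only [VD]; linarith [xa_le_one q.1 l]
  · exact xa_nonneg q.1 l
  · exact K_nonneg q.2 l l'

/-- integrating `costR` against the chain. -/
lemma cake_cost (a b : Finset (Fin n)) (w : Fin n → ℝ) :
    ∑ k : Fin (n + 1), wt (cvec a w) k * costR a (Tset (cvec a w) k) b =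
      ∑ l, ((1 - chat (cvec a w) l) * xa a l * xa b l + chat (cvec a w) l * (1 - xa a l) * (1 - xa b l)) := by
  unfold costR
  simp_rw [Finset.mul_sum]
  rw [Finset.sum_comm]
  refine Finset.sum_congr rfl (fun l _ => ?_)
  have h1 := cake_coord (cvec a w) l
  have h2 := sum_wt (cvec a w)
  have e : ∀ k : Fin (n + 1), wt (cvec a w) k *
      ((1 - xa (Tset (cvec a w) k) l) * xa a l * xa b l + xa (Tset (cvec a w) k) l * (1 - xa a l) * (1 - xa b l)) =
      (xa a l * xa b l) * wt (cvec a w) k +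
        ((1 - xa a l) * (1 - xa b l) - xa a l * xa b l) * (wt (cvec a w) k * xa (Tset (cvec a w) k) l) := by
    intro k; ring
  simp_rw [e]
  rw [Finset.sum_add_distrib, ← Finset.mul_sum, ← Finset.mul_sum, h1, h2]
  ring

/-- integrating `invR` against the chain. -/
lemma cake_inv (a : Finset (Fin n)) (w : Fin n → ℝ) (π : Equiv.Perm (Fin n)) :
    ∑ k : Fin (n + 1), wt (cvec a w) k * invR (Tset (cvec a w) k) π =
      ∑ l, ∑ l', posPart' (chat (cvec a w) l - chat (cvec a w) l') * K π l l' := by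
  unfold invR
  simp_rw [Finset.mul_sum]
  rw [Finset.sum_comm]
  refine Finset.sum_congr rfl (fun l _ => ?_)
  rw [Finset.sum_comm]
  refine Finset.sum_congr rfl (fun l' _ => ?_)
  have h := cake_pair (cvec a w) l l'
  have e : ∀ k : Fin (n + 1), wt (cvec a w) k *
      (xa (Tset (cvec a w) k) l * (1 - xa (Tset (cvec a w) k) l') * K π l l') =
      (wt (cvec a w) k * (xa (Tset (cvec a w) k) l * (1 - xa (Tset (cvec a w) k) l'))) * K π l l' := by
    intro k; ring
  simp_rw [e]
  rw [← Finset.sum_mul, h]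

/-- **the layer-cake factorization identity** `Sdiag = UD · VDᵀ`. -/
theorem factorizationD (lam : ℝ) (a : Finset (Fin n)) (w : Fin n → ℝ) (b : Finset (Fin n)) (π : Equiv.Perm (Fin n)) :
    ∑ s : SlotD n, UD lam (a, w) s * VD lam (b, π) s = Sdiag lam a w b π := by
  rw [Fintype.sum_sum_type, Fintype.sum_sum_type, Fintype.sum_sum_type]
  -- the reduced part
  have hred : ∑ s : Slot n, UD lam (a, w) (Sum.inl s) * VD lam (b, π) (Sum.inl s) =
      ∑ k : Fin (n + 1), wt (cvec a w) k * Mred lam a (Tset (cvec a w) k) b π := by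
    simp only [UD, VD]
    simp_rw [Finset.sum_mul]
    rw [Finset.sum_comm]
    refine Finset.sum_congr rfl (fun k _ => ?_)
    rw [← factorization lam a (Tset (cvec a w) k) b π, Finset.mul_sum]
    refine Finset.sum_congr rfl (fun s _ => by ring)
  have hM : ∀ k : Fin (n + 1), wt (cvec a w) k * Mred lam a (Tset (cvec a w) k) b π =
      (1 - ∑ l, xa a l * xa b l) ^ 2 * wt (cvec a w) k + wt (cvec a w) k * costR a (Tset (cvec a w) k) b
        + lam * (wt (cvec a w) k * invR (Tset (cvec a w) k) π) := by
    intro k; unfold Mred; ring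
  rw [hred]
  simp_rw [hM]
  rw [Finset.sum_add_distrib, Finset.sum_add_distrib, ← Finset.mul_sum, ← Finset.mul_sum, sum_wt,
    cake_cost, cake_inv]
  -- the atoms
  have hA1 : ∑ l : Fin n, UD lam (a, w) (Sum.inr (Sum.inl (Sum.inl l))) * VD lam (b, π) (Sum.inr (Sum.inl (Sum.inl l))) =
      ∑ l, posPart' (cvec a w l - 1) * (1 - xa b l) := by simp only [UD, VD]
  have hA2 : ∑ l : Fin n, UD lam (a, w) (Sum.inr (Sum.inl (Sum.inr l))) * VD lam (b, π) (Sum.inr (Sum.inl (Sum.inr l))) =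
      ∑ l, posPart' (-(cvec a w l)) * xa b l := by simp only [UD, VD]
  have hA3 : ∑ p : Fin n × Fin n, UD lam (a, w) (Sum.inr (Sum.inr p)) * VD lam (b, π) (Sum.inr (Sum.inr p)) =
      lam * ∑ l, ∑ l', posPart' (cvec a w l - cvec a w l') * K π l l'
        - lam * ∑ l, ∑ l', posPart' (chat (cvec a w) l - chat (cvec a w) l') * K π l l' := by
    rw [Fintype.sum_prod_type, Finset.mul_sum, Finset.mul_sum, ← Finset.sum_sub_distrib]
    refine Finset.sum_congr rfl (fun l _ => ?_)
    rw [Finset.mul_sum, Finset.mul_sum, ← Finset.sum_sub_distrib]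
    refine Finset.sum_congr rfl (fun l' _ => ?_)
    simp only [UD, VD]; ring
  rw [hA1, hA2, hA3]
  -- per-coordinate cost atoms
  have hcost : ∑ l, (posPart' (w l) * (1 - xa b l) + posPart' (-(w l)) * xa b l) =
      ∑ l, ((1 - chat (cvec a w) l) * xa a l * xa b l + chat (cvec a w) l * (1 - xa a l) * (1 - xa b l))
        + ∑ l, posPart' (cvec a w l - 1) * (1 - xa b l) + ∑ l, posPart' (-(cvec a w l)) * xa b l := by
    rw [← Finset.sum_add_distrib, ← Finset.sum_add_distrib]
    refine Finset.sum_congr rfl (fun l _ => ?_)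
    have hα : xa a l = 0 ∨ xa a l = 1 := by unfold xa; split_ifs <;> simp
    have hβ : xa b l = 0 ∨ xa b l = 1 := by unfold xa; split_ifs <;> simp
    have := cost_atom (w l) (xa a l) (xa b l) hα hβ
    simp only [cvec, chat]
    linarith
  unfold Sdiag Def
  rw [hcost]
  simp only [cvec]
  ring

/-- **Main theorem (K3).**  The located-pencil slack of the permutahedral passenger `Q^Π_{4n}` at EVERY real diagonal tilt of
every clique row is blind: `(1 − |a∩b|)² + Σ_l (w_l⁺(1−b_l) + w_l⁻ b_l) + 4n·Σ_{l,l'} (c_l − c_l')⁺[π l' < π l]` (`c = 𝟙_a + w`)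
has a nonnegative factorization with `(n+1)³(16n²+1) + 2n + n²` slots, rows `(a,w) ∈ Finset × (Fin n → ℝ)`, columns `(b,π)`. -/
theorem permPassenger_diagTiltBlind (n : ℕ) (hn : 1 ≤ n) :
    ∃ (U : Finset (Fin n) × (Fin n → ℝ) → SlotD n → ℝ) (V : Finset (Fin n) × Equiv.Perm (Fin n) → SlotD n → ℝ),
      Fintype.card (SlotD n) = (n + 1) ^ 3 * (16 * n ^ 2 + 1) + (2 * n + n ^ 2) ∧
      (∀ r s, 0 ≤ U r s) ∧ (∀ q s, 0 ≤ V q s) ∧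
      ∀ (a : Finset (Fin n)) (w : Fin n → ℝ) (b : Finset (Fin n)) (π : Equiv.Perm (Fin n)),
        (1 - ((a ∩ b).card : ℝ)) ^ 2
          + (∑ l, (max (w l) 0 * (if l ∈ b then 0 else 1) + max (-(w l)) 0 * (if l ∈ b then 1 else 0)))
          + (4 * n) * ∑ l, ∑ l', max ((if l ∈ a then 1 else 0) + w l - ((if l' ∈ a then 1 else 0) + w l')) 0 *
              (if (π l' : ℕ) < (π l : ℕ) then 1 else 0)
          = ∑ s, U (a, w) s * V (b, π) s := by
  have hlam : 4 * (n : ℝ) ≤ 4 * n := le_rfl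
  have hlam1 : (1 : ℝ) ≤ 4 * n := by
    have : (1 : ℝ) ≤ n := by exact_mod_cast hn
    linarith
  refine ⟨UD (4 * n), VD (4 * n), card_SlotD n, UD_nonneg _ (by positivity), VD_nonneg _ hlam hlam1, ?_⟩
  intro a w b π
  rw [factorizationD, Sdiag, sum_xa_mul_xa, Def]
  congr 2
  refine Finset.sum_congr rfl (fun l _ => ?_)
  unfold posPart' xa
  by_cases h : l ∈ b <;> simp [h]

end diag

end

end Summit.ValiantsHypothesis.ValiantsHypothesis.Cruxes.NNDivisionHard.PermTiltBlind41
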